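import Summits.CriticalPhenomena.CardyFormulaZ2.Theorems.CardyWhiteToColouredSimilarityUpgradeStubRectangleDuality

/-!
# Stub `stub_rectangleContinuity` (line `registered`, crux `SimilarityUpgrade`, stmt-CriticalPhenomena-4597)

Crux `Summit.CriticalPhenomena.CardyFormulaZ2.Theses.CardyWhiteToColoured.SimilarityUpgrade`,
line `registered` (skeleton `Cruxes/SimilarityUpgrade/Lines/birth.lean`), stub **T3**
`stub_rectangleContinuity`: the uniform increment estimate in ε-form (adding at most `ε k`
columns to a lattice box `[0, m] × [0, k]` of comparable sides, `a k ≤ m ≤ k / a`, moves the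
left–right crossing probability at `p = 1/2` by at most `η`, uniformly in `k ≥ k₀`) together with
the existence of the full scaling limits `Φ` of the bond-ℤ² crossing probabilities implies that
`w ↦ Φ (Q w)` is continuous on `(0, ∞)` for every left–right box family `Q` (`Q w` is the box
`(0, w) × (0, 1)` crossed from its left side, arc `0`, to its right side, arc `2`).

Proof. At mesh `δ = 1/(k+2)` the crossing event of `Q w` IS the left–right crossing of the
lattice box `[1, a + 1] × [1, k + 1]` with `a + 1 < w (k + 2) ≤ a + 2`, so
`bondDomainCrossingProb (Q w) (1/(k+2)) = crossingProb half a k` (`RectangleDuality.bond_lr_eq`,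
stub D of the same line) and `Φ (Q w)` is the limit of these numbers along `k → ∞`. For
`w₀ / 2 < w₁ ≤ w₂ < 2 w₀` with `w₂ - w₁ ≤ ε / 4` the two windows `a₁, a₂` at level `k` satisfy
`a₁ ≤ a₂ < a₁ + (w₂ - w₁)(k + 2) + 1 ≤ a₁ + ε k` and `a k ≤ a₁ ≤ k / a` for
`a = min (w₀ / 4) (1 / (4 w₀))` and `k` large, so the increment estimate gives
`|crossingProb half a₁ k - crossingProb half a₂ k| ≤ η / 2` eventually in `k`; the bound passes to
the limit (`le_of_tendsto`), giving `|Φ (Q w₁) - Φ (Q w₂)| ≤ η / 2 < η` whenever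
`|w - w₀| < min (w₀ / 2) (ε / 4)`. No arm estimates and no definitions are introduced here.

References: B. Bollobás, O. Riordan, *Percolation* (2006), Ch. 7 §7.1 pp. 183–185 (crossings of
rectangles `[0, a] × [0, b]` in the scaling limit); G. Grimmett, *Percolation* (1999), §11.7.
-/

noncomputable section

namespace Summit.CriticalPhenomena.CardyFormulaZ2.Cruxes.SimilarityUpgrade.Stubs

open Filter Topology Set
open Literature.Probability.RandomPlanarGeometry
open Literature.Probability.Percolation

open RectangleDuality in
/-- **stub_rectangleContinuity (T3 = H1 from the ε-form).** If adding `≤ ε k` columns to a box of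
comparable sides moves the crossing probability by at most `η` uniformly in `k ≥ k₀`, then for every
full-limit `Φ` and every left–right box family `Q`, `w ↦ Φ (Q w)` is continuous on `(0, ∞)`: by
`RectangleDuality.bond_lr_eq`, `Φ (Q w) = lim_k crossingProb half (a_k w) k` with
`a_k w + 1 < w (k+2) ≤ a_k w + 2`, and `0 ≤ a_k w₂ - a_k w₁ < (w₂ - w₁) (k+2) + 1` for `w₁ ≤ w₂`.
[cite: BollobasRiordan2006, Ch. 7 §7.1 pp. 183–185] -/
theorem stub_rectangleContinuity :
    (∀ a : ℝ, 0 < a → ∀ η : ℝ, 0 < η → ∃ ε : ℝ, 0 < ε ∧ ∃ k₀ : ℕ, ∀ k m j : ℕ, k₀ ≤ k →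
        a * k ≤ m → (m : ℝ) ≤ k / a → (j : ℝ) ≤ ε * k →
        |crossingProb half m k - crossingProb half (m + j) k| ≤ η) →
    ∀ Φ : ConformalRectangle → ℝ,
      (∀ R : ConformalRectangle, Tendsto (bondDomainCrossingProb R) (𝓝[>] (0 : ℝ)) (𝓝 (Φ R))) →
      ∀ Q : ℝ → ConformalRectangle,
        (∀ w : ℝ, 0 < w → (Q w).carrier = (Ioo (0 : ℝ) w ×ℂ Ioo (0 : ℝ) 1) ∧
          (Q w).arc 0 = {z : ℂ | z.re = 0 ∧ z.im ∈ Icc (0 : ℝ) 1} ∧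
          (Q w).arc 2 = {z : ℂ | z.re = w ∧ z.im ∈ Icc (0 : ℝ) 1}) →
        ContinuousOn (fun w => Φ (Q w)) (Ioi 0) := by
  intro hinc Φ hlim Q hQ
  -- windows: every real `x > 1` lies in some `(a + 1, a + 2]`, `a : ℕ`
  have exists_window : ∀ {x : ℝ}, 1 < x → ∃ a : ℕ, (a : ℝ) + 1 < x ∧ x ≤ a + 2 := by
    intro x hx
    have h2 : 2 ≤ ⌈x⌉₊ := Nat.lt_ceil.2 (by exact_mod_cast hx)
    refine ⟨⌈x⌉₊ - 2, ?_, ?_⟩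
    · have h := Nat.ceil_lt_add_one (by linarith : (0 : ℝ) ≤ x)
      rw [Nat.cast_sub h2]; push_cast; linarith
    · have h := Nat.le_ceil x
      rw [Nat.cast_sub h2]; push_cast; linarith
  -- the meshes `1 / (k + 2)` tend to `0⁺`
  have tendsto_mesh : Tendsto (fun k : ℕ => (1 : ℝ) / ((k : ℝ) + 2)) atTop (𝓝[>] (0 : ℝ)) := by
    rw [tendsto_nhdsWithin_iff]
    refine ⟨tendsto_const_nhds.div_atTop
      (tendsto_natCast_atTop_atTop.atTop_add tendsto_const_nhds), Eventually.of_forall fun k => ?_⟩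
    show (0 : ℝ) < 1 / ((k : ℝ) + 2)
    positivity
  -- the full limits along the meshes `1 / (k + 2)`
  have hlimk : ∀ R : ConformalRectangle,
      Tendsto (fun k : ℕ => bondDomainCrossingProb R (1 / ((k : ℝ) + 2))) atTop (𝓝 (Φ R)) :=
    fun R => (hlim R).comp tendsto_mesh
  -- exact identification of `bond (Q w) (1/(k+2))` with a lattice box crossing probability
  have hident : ∀ w : ℝ, 0 < w → ∀ k : ℕ, 2 < w * ((k : ℝ) + 2) → ∃ a : ℕ,
      ((a : ℝ) + 1 < w * ((k : ℝ) + 2) ∧ w * ((k : ℝ) + 2) ≤ (a : ℝ) + 2) ∧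
      bondDomainCrossingProb (Q w) (1 / ((k : ℝ) + 2)) = crossingProb half a k := by
    intro w hw k hk
    have hK : (0 : ℝ) < (k : ℝ) + 2 := by positivity
    obtain ⟨a, ha1, ha2⟩ := exists_window (x := w * ((k : ℝ) + 2)) (by linarith)
    have hδ : (0 : ℝ) < 1 / ((k : ℝ) + 2) := by positivity
    have ha : 1 / ((k : ℝ) + 2) * (a + 1) < w := by
      rwa [one_div_mul_eq_div, div_lt_iff₀ hK]
    have ha' : w ≤ 1 / ((k : ℝ) + 2) * (a + 2) := by
      rwa [one_div_mul_eq_div, le_div_iff₀ hK]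
    have hb : 1 / ((k : ℝ) + 2) * ((k : ℝ) + 2) = 1 := one_div_mul_cancel hK.ne'
    have h1a : 1 ≤ a := by
      have : (0 : ℝ) < a := by linarith
      have : 0 < a := by exact_mod_cast this
      omega
    exact ⟨a, ⟨ha1, ha2⟩,
      bond_lr_eq (Q w) (hQ w hw).1 (hQ w hw).2.1 (hQ w hw).2.2 hδ ha ha' hb h1a⟩
  -- continuity at every `w₀ > 0`
  intro w₀ hw₀
  replace hw₀ : 0 < w₀ := hw₀
  apply ContinuousAt.continuousWithinAt
  rw [Metric.continuousAt_iff]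
  intro η hη
  -- the comparability constant `a` and the increment data `ε`, `k₀` at accuracy `η / 2`
  obtain ⟨a, ha0, ha1, ha2⟩ : ∃ a : ℝ, 0 < a ∧ a ≤ w₀ / 4 ∧ a ≤ 1 / (4 * w₀) :=
    ⟨min (w₀ / 4) (1 / (4 * w₀)), lt_min (by positivity) (by positivity), min_le_left _ _,
      min_le_right _ _⟩
  obtain ⟨ε, hε, k₀, hk₀⟩ := hinc a ha0 (η / 2) (by positivity)
  -- the key estimate
  have key : ∀ w₁ w₂ : ℝ, w₀ / 2 < w₁ → w₁ ≤ w₂ → w₂ < 2 * w₀ → w₂ - w₁ ≤ ε / 4 →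
      |Φ (Q w₁) - Φ (Q w₂)| ≤ η / 2 := by
    intro w₁ w₂ hw₁ h12 hw₂ hd
    have hw₁0 : 0 < w₁ := by linarith
    have hw₂0 : 0 < w₂ := by linarith
    refine le_of_tendsto ((hlimk (Q w₁)).sub (hlimk (Q w₂))).abs ?_
    obtain ⟨K₁, hK₁⟩ := exists_nat_ge (8 / w₀ + 2 / ε + 2)
    filter_upwards [eventually_ge_atTop (max k₀ K₁)] with k hk
    have hkk₀ : k₀ ≤ k := le_of_max_le_left hk
    have hkK₁ : (K₁ : ℝ) ≤ k := by exact_mod_cast le_of_max_le_right hk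
    have hp1 : 0 < 8 / w₀ := by positivity
    have hp2 : 0 < 2 / ε := by positivity
    have hk1 : 8 / w₀ ≤ k := by linarith
    have hk2 : 2 / ε ≤ (k : ℝ) - 2 := by linarith
    have hk3 : (2 : ℝ) ≤ k := by linarith
    rw [div_le_iff₀ hw₀] at hk1
    rw [div_le_iff₀ hε] at hk2
    -- products used by `linarith`
    have hm1 : w₀ / 2 * ((k : ℝ) + 2) ≤ w₁ * ((k : ℝ) + 2) :=
      mul_le_mul_of_nonneg_right hw₁.le (by positivity)
    have hm2 : w₂ * ((k : ℝ) + 2) ≤ 2 * w₀ * ((k : ℝ) + 2) :=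
      mul_le_mul_of_nonneg_right hw₂.le (by positivity)
    have hm12 : w₁ * ((k : ℝ) + 2) ≤ w₂ * ((k : ℝ) + 2) :=
      mul_le_mul_of_nonneg_right h12 (by positivity)
    have hm3 : (w₂ - w₁) * ((k : ℝ) + 2) ≤ ε / 4 * ((k : ℝ) + 2) :=
      mul_le_mul_of_nonneg_right hd (by positivity)
    have hm4 : w₀ * 2 ≤ w₀ * k := mul_le_mul_of_nonneg_left hk3 hw₀.le
    have hwk₁ : 2 < w₁ * ((k : ℝ) + 2) := by linarith
    have hwk₂ : 2 < w₂ * ((k : ℝ) + 2) := by linarith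
    obtain ⟨a₁, ⟨h1l, h1u⟩, hEq₁⟩ := hident w₁ hw₁0 k hwk₁
    obtain ⟨a₂, ⟨h2l, h2u⟩, hEq₂⟩ := hident w₂ hw₂0 k hwk₂
    show |bondDomainCrossingProb (Q w₁) (1 / ((k : ℝ) + 2)) -
      bondDomainCrossingProb (Q w₂) (1 / ((k : ℝ) + 2))| ≤ η / 2
    rw [hEq₁, hEq₂]
    have hle : a₁ ≤ a₂ := by
      have : (a₁ : ℝ) < a₂ + 1 := by linarith
      have : a₁ < a₂ + 1 := by exact_mod_cast this
      omega
    obtain ⟨j, rfl⟩ : ∃ j, a₂ = a₁ + j := ⟨a₂ - a₁, by omega⟩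
    push_cast at h2l h2u
    refine hk₀ k a₁ j hkk₀ ?_ ?_ ?_
    · -- `a k ≤ a₁`
      have : a * k ≤ w₀ / 4 * k := mul_le_mul_of_nonneg_right ha1 (Nat.cast_nonneg k)
      linarith
    · -- `a₁ ≤ k / a`
      rw [le_div_iff₀ ha0]
      have h4 : (0 : ℝ) < 4 * w₀ := by positivity
      have h5 : (a₁ : ℝ) * a ≤ a₁ * (1 / (4 * w₀)) :=
        mul_le_mul_of_nonneg_left ha2 (Nat.cast_nonneg _)
      have h6 : (a₁ : ℝ) * (1 / (4 * w₀)) ≤ k := by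
        rw [mul_one_div, div_le_iff₀ h4]
        linarith
      linarith
    · -- `j ≤ ε k`
      linarith
  refine ⟨min (w₀ / 2) (ε / 4), lt_min (by positivity) (by positivity), fun w hw => ?_⟩
  have hw1 : |w - w₀| < w₀ / 2 := by
    rw [← Real.dist_eq]; exact lt_of_lt_of_le hw (min_le_left _ _)
  have hw2 : |w - w₀| < ε / 4 := by
    rw [← Real.dist_eq]; exact lt_of_lt_of_le hw (min_le_right _ _)
  rw [abs_lt] at hw1 hw2
  rw [Real.dist_eq]
  rcases le_total w w₀ with h | h
  · have := key w w₀ (by linarith) h (by linarith) (by linarith)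
    linarith
  · have := key w₀ w (by linarith) h (by linarith) (by linarith)
    rw [abs_sub_comm]
    linarith

end Summit.CriticalPhenomena.CardyFormulaZ2.Cruxes.SimilarityUpgrade.Stubs

end
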